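import Summits.Parity.GeneralizedHardyLittlewood.Theses.LiouvilleShiftedTables

/-!
# Route LiouvilleShiftedTables — the glue `TableToDilated` (stmt-Parity-14840)

`TableToDilated : TableChowla → LargeDilatedTableChowla → DilatedTableChowla`.

Proof.
1. *Positivity.* For finsets `U ⊆ S`, `V ⊆ T` and any real table `m`,
   `∑_{a,a' ∈ U} (∑_{b ∈ V} m a b * m a' b)² ≤ ∑_{a,a' ∈ S} (∑_{b ∈ T} m a b * m a' b)²`:
   expanding the square and swapping the finite sums, the block fourth moment is a sum of
   non-negative squares indexed by `U × U` for fixed `V`, and by `V × V` for fixed `U`, so it is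
   monotone in both.  Hence every `(q,u,v)`-term of `DilatedTableChowla` (rows `a ≡ u q`, columns
   `b ≡ v q`) is at most the `TableChowla` double sum `T(x,A,c)`.
2. *Splitting the dilations.* Split `q ≤ x^{δ/2}` at `M = ⌊(log x)^K⌋₊`: the part `q ≤ M` has at
   most `M ≤ (log x)^K` terms, each at most `((log x)^K)³ · T`, so it is at most
   `(log x)^{4K} · x² / (log x)^{C+1+4K} = x² / (log x)^{C+1}` by `TableChowla` at exponent
   `C + 1 + 4K`; the part `q > M` lies in the band `(log x)^K < q ≤ x^{δ/2}` of
   `LargeDilatedTableChowla` at exponent `C + 1`.  The total `2x²/(log x)^{C+1}` is at most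
   `x²/(log x)^C` once `log x ≥ 2`.
-/

namespace Summit.Parity.GeneralizedHardyLittlewood.Theorems

open Summit.Parity.GeneralizedHardyLittlewood.Theses.LiouvilleShiftedTables

/-- A double sum of non-negative terms over `U × U` is monotone in the finset `U`. -/
theorem tableToDilated_sum_sum_mono {U S : Finset ℕ} (hUS : U ⊆ S) (g : ℕ → ℕ → ℝ)
    (hg : ∀ a a', 0 ≤ g a a') :
    ∑ a ∈ U, ∑ a' ∈ U, g a a' ≤ ∑ a ∈ S, ∑ a' ∈ S, g a a' :=
  calc ∑ a ∈ U, ∑ a' ∈ U, g a a' ≤ ∑ a ∈ U, ∑ a' ∈ S, g a a' :=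
        Finset.sum_le_sum fun a _ =>
          Finset.sum_le_sum_of_subset_of_nonneg hUS fun a' _ _ => hg a a'
    _ ≤ ∑ a ∈ S, ∑ a' ∈ S, g a a' :=
        Finset.sum_le_sum_of_subset_of_nonneg hUS fun a _ _ =>
          Finset.sum_nonneg fun a' _ => hg a a'

/-- Rows and columns of a block fourth moment can be exchanged:
`∑_{a,a' ∈ U} (∑_{b ∈ V} m a b * m a' b)² = ∑_{b,b' ∈ V} (∑_{a ∈ U} m a b * m a b')²`
(expand both squares and swap the finite sums). -/
theorem tableToDilated_fourth_moment_swap (U V : Finset ℕ) (m : ℕ → ℕ → ℝ) :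
    ∑ a ∈ U, ∑ a' ∈ U, (∑ b ∈ V, m a b * m a' b) ^ 2 =
      ∑ b ∈ V, ∑ b' ∈ V, (∑ a ∈ U, m a b * m a b') ^ 2 := by
  have h1 : ∀ a a', (∑ b ∈ V, m a b * m a' b) ^ 2 =
      ∑ b ∈ V, ∑ b' ∈ V, m a b * m a' b * (m a b' * m a' b') := fun a a' => by
    rw [sq, Finset.sum_mul_sum]
  have h2 : ∀ b b', (∑ a ∈ U, m a b * m a b') ^ 2 =
      ∑ a ∈ U, ∑ a' ∈ U, m a b * m a' b * (m a b' * m a' b') := fun b b' => by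
    rw [sq, Finset.sum_mul_sum]
    exact Finset.sum_congr rfl fun a _ => Finset.sum_congr rfl fun a' _ => by ring
  simp_rw [h1, h2]
  calc ∑ a ∈ U, ∑ a' ∈ U, ∑ b ∈ V, ∑ b' ∈ V, m a b * m a' b * (m a b' * m a' b')
      = ∑ a ∈ U, ∑ b ∈ V, ∑ b' ∈ V, ∑ a' ∈ U, m a b * m a' b * (m a b' * m a' b') :=
        Finset.sum_congr rfl fun a _ =>
          Finset.sum_comm.trans (Finset.sum_congr rfl fun b _ => Finset.sum_comm)
    _ = ∑ b ∈ V, ∑ a ∈ U, ∑ b' ∈ V, ∑ a' ∈ U, m a b * m a' b * (m a b' * m a' b') :=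
        Finset.sum_comm
    _ = ∑ b ∈ V, ∑ b' ∈ V, ∑ a ∈ U, ∑ a' ∈ U, m a b * m a' b * (m a b' * m a' b') :=
        Finset.sum_congr rfl fun b _ => Finset.sum_comm

/-- **Positivity step.** Block fourth moments are monotone under restriction of rows and
columns: for `U ⊆ S`, `V ⊆ T`,
`∑_{a,a' ∈ U} (∑_{b ∈ V} m a b * m a' b)² ≤ ∑_{a,a' ∈ S} (∑_{b ∈ T} m a b * m a' b)²`. -/
theorem tableToDilated_block_fourth_moment_le {U S V T : Finset ℕ} (hUS : U ⊆ S) (hVT : V ⊆ T)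
    (m : ℕ → ℕ → ℝ) :
    ∑ a ∈ U, ∑ a' ∈ U, (∑ b ∈ V, m a b * m a' b) ^ 2 ≤
      ∑ a ∈ S, ∑ a' ∈ S, (∑ b ∈ T, m a b * m a' b) ^ 2 :=
  calc ∑ a ∈ U, ∑ a' ∈ U, (∑ b ∈ V, m a b * m a' b) ^ 2
      ≤ ∑ a ∈ S, ∑ a' ∈ S, (∑ b ∈ V, m a b * m a' b) ^ 2 :=
        tableToDilated_sum_sum_mono hUS _ fun _ _ => sq_nonneg _
    _ = ∑ b ∈ V, ∑ b' ∈ V, (∑ a ∈ S, m a b * m a b') ^ 2 :=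
        tableToDilated_fourth_moment_swap S V m
    _ ≤ ∑ b ∈ T, ∑ b' ∈ T, (∑ a ∈ S, m a b * m a b') ^ 2 :=
        tableToDilated_sum_sum_mono hVT (fun b b' => (∑ a ∈ S, m a b * m a b') ^ 2)
          fun _ _ => sq_nonneg _
    _ = ∑ a ∈ S, ∑ a' ∈ S, (∑ b ∈ T, m a b * m a' b) ^ 2 :=
        (tableToDilated_fourth_moment_swap S T m).symm

/-- **Splitting step** (abstract form). If `0 ≤ F q ≤ T` for all `q`, `T ≤ x²/L^{C+1+4K}`, the band
`⌊L^K⌋₊ < q ≤ N` contributes at most `x²/L^{C+1}`, and `L ≥ 2`, then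
`∑_{1 ≤ q ≤ N} q³ F q ≤ x²/L^C`. -/
theorem tableToDilated_split {N M K : ℕ} {F : ℕ → ℝ} {T x L C : ℝ}
    (hT : T ≤ x ^ 2 / L ^ (C + 1 + 4 * K))
    (hlarge : ∑ q ∈ Finset.Ioc M N, (q : ℝ) ^ 3 * F q ≤ x ^ 2 / L ^ (C + 1))
    (hM : M = ⌊L ^ K⌋₊) (hL : 2 ≤ L) (hF0 : ∀ q, 0 ≤ F q) (hFT : ∀ q, F q ≤ T) :
    ∑ q ∈ Finset.Icc 1 N, (q : ℝ) ^ 3 * F q ≤ x ^ 2 / L ^ C := by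
  have hL0 : 0 < L := by linarith
  have hT0 : 0 ≤ T := (hF0 0).trans (hFT 0)
  set P : ℝ := L ^ K with hP
  have hP0 : 0 < P := pow_pos hL0 K
  have hMP : (M : ℝ) ≤ P := by
    rw [hM]
    exact Nat.floor_le hP0.le
  -- the Siegel range `q ≤ M`: at most `M` terms, each at most `P ^ 3 * T`
  have hsmall : ∑ q ∈ (Finset.Icc 1 N).filter (fun q => q ≤ M), (q : ℝ) ^ 3 * F q ≤
      P ^ 4 * T := by
    calc ∑ q ∈ (Finset.Icc 1 N).filter (fun q => q ≤ M), (q : ℝ) ^ 3 * F q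
        ≤ ∑ q ∈ (Finset.Icc 1 N).filter (fun q => q ≤ M), P ^ 3 * T := by
          refine Finset.sum_le_sum fun q hq => ?_
          have hqM : q ≤ M := (Finset.mem_filter.1 hq).2
          have hqP : (q : ℝ) ≤ P := le_trans (by exact_mod_cast hqM) hMP
          exact mul_le_mul (pow_le_pow_left₀ (Nat.cast_nonneg q) hqP 3) (hFT q) (hF0 q)
            (by positivity)
      _ = ((Finset.Icc 1 N).filter (fun q => q ≤ M)).card * (P ^ 3 * T) := by
          rw [Finset.sum_const, nsmul_eq_mul]
      _ ≤ M * (P ^ 3 * T) := by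
          have hcard : ((Finset.Icc 1 N).filter (fun q => q ≤ M)).card ≤ M :=
            calc ((Finset.Icc 1 N).filter (fun q => q ≤ M)).card ≤ (Finset.Icc 1 M).card :=
                  Finset.card_le_card fun q hq => by
                    simp only [Finset.mem_filter, Finset.mem_Icc] at hq ⊢
                    exact ⟨hq.1.1, hq.2⟩
              _ = M := by simp
          have hPT : 0 ≤ P ^ 3 * T := by positivity
          exact mul_le_mul_of_nonneg_right (by exact_mod_cast hcard) hPT
      _ ≤ P * (P ^ 3 * T) := by
          have hPT : 0 ≤ P ^ 3 * T := by positivity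
          exact mul_le_mul_of_nonneg_right hMP hPT
      _ = P ^ 4 * T := by ring
  -- the band `q > M` is inside `Finset.Ioc M N`
  have hbig : ∑ q ∈ (Finset.Icc 1 N).filter (fun q => ¬ q ≤ M), (q : ℝ) ^ 3 * F q ≤
      x ^ 2 / L ^ (C + 1) := by
    refine le_trans (Finset.sum_le_sum_of_subset_of_nonneg ?_ ?_) hlarge
    · intro q hq
      simp only [Finset.mem_filter, Finset.mem_Icc, not_le] at hq
      exact Finset.mem_Ioc.2 ⟨hq.2, hq.1.2⟩
    · intro q _ _
      exact mul_nonneg (by positivity) (hF0 q)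
  -- `P ^ 4 * T ≤ x² / L^{C+1}`
  have h4 : L ^ (4 * (K : ℝ)) = P ^ 4 := by
    rw [hP, ← pow_mul, ← Real.rpow_natCast]
    push_cast
    rw [mul_comm]
  have hPT : P ^ 4 * T ≤ x ^ 2 / L ^ (C + 1) := by
    calc P ^ 4 * T ≤ P ^ 4 * (x ^ 2 / L ^ (C + 1 + 4 * K)) :=
          mul_le_mul_of_nonneg_left hT (by positivity)
      _ = x ^ 2 / L ^ (C + 1) := by
          rw [Real.rpow_add hL0, h4]
          field_simp
  calc ∑ q ∈ Finset.Icc 1 N, (q : ℝ) ^ 3 * F q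
      = (∑ q ∈ (Finset.Icc 1 N).filter (fun q => q ≤ M), (q : ℝ) ^ 3 * F q) +
          ∑ q ∈ (Finset.Icc 1 N).filter (fun q => ¬ q ≤ M), (q : ℝ) ^ 3 * F q :=
        (Finset.sum_filter_add_sum_filter_not _ _ _).symm
    _ ≤ x ^ 2 / L ^ (C + 1) + x ^ 2 / L ^ (C + 1) := add_le_add (hsmall.trans hPT) hbig
    _ ≤ x ^ 2 / L ^ C := by
        rw [Real.rpow_add hL0, Real.rpow_one, div_mul_eq_div_mul_one_div]
        have hy : 0 ≤ x ^ 2 / L ^ C := div_nonneg (sq_nonneg x) (Real.rpow_nonneg hL0.le C)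
        have ht : 1 / L ≤ 1 / 2 := one_div_le_one_div_of_le two_pos hL
        nlinarith

/-- The glue item `TableToDilated` of route LiouvilleShiftedTables (stmt-Parity-14840):
`TableChowla → LargeDilatedTableChowla → DilatedTableChowla`.  The `q = 1` table dominates every
`(q,u,v)`-block by positivity (`tableToDilated_block_fourth_moment_le`), which pays for the whole
Siegel range `q ≤ (log x)^K` with `TableChowla` at exponent `C + 1 + 4K`; the remaining band is
`LargeDilatedTableChowla` at exponent `C + 1` (`tableToDilated_split`). -/
theorem tableToDilated_proof :
    Summit.Parity.GeneralizedHardyLittlewood.Theses.LiouvilleShiftedTables.TableToDilated := by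
  unfold Summit.Parity.GeneralizedHardyLittlewood.Theses.LiouvilleShiftedTables.TableToDilated
  intro hT hL c hc δ hδ hδ' C hC
  obtain ⟨K, x₁, hx₁⟩ := hL c hc δ hδ hδ' (C + 1) (by linarith)
  obtain ⟨x₂, hx₂⟩ := hT c hc δ hδ hδ' (C + 1 + 4 * K) (by positivity)
  refine ⟨max (max x₁ x₂) (Real.exp 2), fun x hx A hA hA' u v => ?_⟩
  have hx1 : x₁ ≤ x := le_trans (le_trans (le_max_left _ _) (le_max_left _ _)) hx
  have hx2 : x₂ ≤ x := le_trans (le_trans (le_max_right _ _) (le_max_left _ _)) hx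
  have hxe : Real.exp 2 ≤ x := le_trans (le_max_right _ _) hx
  have hx0 : 0 < x := lt_of_lt_of_le (Real.exp_pos 2) hxe
  have hlog : 2 ≤ Real.log x := (Real.le_log_iff_exp_le hx0).2 hxe
  refine tableToDilated_split (hx₂ x hx2 A hA hA') (hx₁ x hx1 A hA hA' u v) rfl hlog ?_ ?_
  · intro q
    positivity
  · intro q
    exact tableToDilated_block_fourth_moment_le (Finset.filter_subset _ _)
      (Finset.filter_subset _ _) _

end Summit.Parity.GeneralizedHardyLittlewood.Theorems
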